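import Literature.MathematicalPhysics.QuantumFieldTheory.Balaban1983to89.HaarExpChartClosedSubgroup

/-!
# `Balaban1983to89.HaarExpChartPi` — [Helgason2000] Ch. I §1 Thm. 1.14 (13) as a MEASURE-PRESERVING chart, and its
# product over a finite bond set: «∫dU′↾_{Ω₁} … dU′ = σ(A′)dA′» of [Balaban1985UV3] (13)→(18) p. 260 for EVERY closed
# `G ≤ U(N)`

statement-level skeleton of published theorems with citation tags; proofs where landed; nothing here is a claim
about the Yang–Mills mass gap

Mega-formalization `lit-balaban` (HOME `run/shared/lean/pub/lit-balaban/`), unit `lit-balaban-p24` gen 12, rider to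
`HaarExpChartClosedSubgroup` (free-target protocol G.5-34(d); referee ref-5).  SKELETON rows served (support, no head
change): B10.Eq13 / B10.Eq18 / B10.Eq21 / display E18 (owner r07): the passage from the Haar integrals `∫dU′↾_{Ω₁}` of
(13) to the Lie-algebra integrals `∫dA′↾_{Ω₁}` of (18) over a FINITE bond set, for a general compact gauge group
(r07's `B10Eq18SigmaSU2Haar` §8 `measurePreserving_pi_expPauli` does this for `SU(2)` with the global quaternion chart;
its caveat «no exponential-chart Haar density for SU(N), N ≥ 3, exists in the tree» is addressed by
`HaarExpChartClosedSubgroup` and, for the many-bond assembly, here).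

CITATION HEADER.  [Helgason2000] Ch. I §1 Thm. 1.14 p. 96 (13) «∫_G f(g) dg = ∫_𝔤 f(exp X) det((1 − e^{−adX})/adX) dX»
(quoted in full in `HaarExpChartClosedSubgroup`); [Balaban1985UV3] T. Bałaban, CMP **102** (1985) p. 260: «To write the
integrals (13) in terms of the variables A′ we express the Haar measure dU′ as dU′ = σ(A′)dA′ = σ₀ σ/σ₀ (A′)dA′ …»,
the integrals (13) being over `∫dU′↾_{Ω₁}` = the product Haar measure over the bonds of `Ω₁`, and (18) the result
«∫dA′↾_{Ω₁} … exp[Σ_b log σ/σ₀(A′(b) − …)]».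

WHAT IS PROVED (0 sorry, no definitions, no named facts; axioms standard).  `G = ↥Gs`, `Gs ≤ U(N)` closed, `𝐠`,
`expG`, `jdet`, `jacMeasure`, `chartMeasure` as in files 1–3; `μ` any Haar measure on `G`, `vol` any additive Haar
measure on `𝐠`, `β` a finite index («bond») set.
* `exists_measurePreserving_expG`: ∃ `0 < r ≤ log 2` (window `N_e = expG(N₀)` open, `expG` injective on `N₀ = {‖X‖<r}`,
  `det jac > 0` on `N₀`) and `σ₀ : ℝ≥0`, `σ₀ ≠ 0`, such that **`expG` is MEASURE-PRESERVING from
  `(N₀, σ₀ · det jac · dX)` to `(N_e, μ)`**: `Measure.map expG (σ₀ • jacMeasure vol r) = μ.restrict N_e`.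
* **`exists_measurePreserving_pi_expG`**: the bondwise chart `A ↦ (expG (A b))_b` is MEASURE-PRESERVING from
  `⊗_b (σ₀ · det jac · dX|_{N₀})` to `⊗_b μ|_{N_e}` (Mathlib `measurePreserving_pi`), hence
  `exists_lintegral_pi_haar_eq_expChart`: `∫ F d(⊗_b μ|_{N_e}) = ∫ F((exp A_b)_b) d(⊗_b σ₀·det jac(A_b)·dA_b|_{N₀})` for
  measurable `F ≥ 0` — the measure-theoretic content of (13) → (18) «∫dU′↾_{Ω₁}» → «∫dA′↾_{Ω₁}» for every closed
  `G ≤ U(N)`.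

HONEST SCOPE.  (i) Only the change of variables of the product Haar measure restricted to the product window is
asserted; the δ-functions, `D̃`, characteristic functions and the action in (13)/(18) are untouched (as in r07's §8).
(ii) `σ₀` existential (Haar uniqueness), common to all bonds.  (iii) Windows: the chart is local (`N_e ∌` large
fields); print's small-field characteristic functions `χ({|A(b)| < g₀p²(g₀)})` live inside such windows once the
radius is small — not threaded here.
-/

noncomputable section

open NormedSpace Metric Set Filter Topology MeasureTheory
open scoped ENNReal NNReal

namespace Literature.MathematicalPhysics.QuantumFieldTheory.Balaban1983to89.HaarExpChartPi

open scoped Matrix.Norms.L2Operator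
open HaarExpChartLocal (jdet jacMeasure isFiniteMeasure_jacMeasure measurable_jdet)
open HaarExpChartClosedSubgroup (chart hlie expG measurable_expG chartMeasure isOpen_image_expG_ball expG_injOn
  exists_haar_restrict_eq_smul_chartMeasure compactSpace)

variable {n : Type*} [Fintype n] [DecidableEq n]
variable (Gs : Subgroup (Matrix.unitaryGroup n ℂ)) (hG : IsClosed (Gs : Set (Matrix.unitaryGroup n ℂ)))
variable [MeasurableSpace (chart Gs hG).lie] [BorelSpace (chart Gs hG).lie]

/-- **Thm. 1.14 (13) as a measure-preserving map**: for every Haar `μ` on `G` and additive Haar `dX` on `𝐠` there are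
`0 < r ≤ log 2` and `σ₀ : ℝ≥0`, `σ₀ ≠ 0`, with `expG_*(σ₀ · det jac · dX|_{‖X‖<r}) = μ|_{expG(‖X‖<r)}` — i.e. `expG`
is measure-preserving between these measures. [cite: Helgason2000, Ch. I §1 Thm. 1.14 (13) p. 96]
[cite: Balaban1985UV3, p. 260] -/
theorem exists_measurePreserving_expG (μ : Measure Gs) [μ.IsHaarMeasure]
    (vol : Measure (chart Gs hG).lie) [vol.IsAddHaarMeasure] :
    ∃ r : ℝ, 0 < r ∧ r ≤ Real.log 2 ∧ IsOpen (expG Gs hG '' ball (0 : (chart Gs hG).lie) r) ∧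
      InjOn (expG Gs hG) (ball (0 : (chart Gs hG).lie) r) ∧
      (∀ X : (chart Gs hG).lie, ‖X‖ < r → 0 < jdet (hlie Gs hG) X ∧ jdet (hlie Gs hG) X < 2) ∧
      ∃ σ₀ : ℝ≥0, σ₀ ≠ 0 ∧
        MeasurePreserving (expG Gs hG) (σ₀ • jacMeasure (chart Gs hG) (hlie Gs hG) vol r)
          (μ.restrict (expG Gs hG '' ball (0 : (chart Gs hG).lie) r)) := by
  obtain ⟨r, hr, hr2, hrρ, hjdet, c, hc0, hctop, hμ⟩ := exists_haar_restrict_eq_smul_chartMeasure Gs hG μ vol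
  refine ⟨r, hr, hr2, isOpen_image_expG_ball Gs hG hr2 hrρ, expG_injOn Gs hG hr2,
    fun X hX => ⟨by linarith [(hjdet X hX).1], (hjdet X hX).2⟩, c.toNNReal, ?_, ?_⟩
  · exact fun h => hc0 ((ENNReal.toNNReal_eq_zero_iff c).1 h |>.resolve_right hctop)
  · refine ⟨measurable_expG Gs hG, ?_⟩
    rw [Measure.map_smul, hμ, ENNReal.smul_def, ENNReal.coe_toNNReal hctop]
    rfl

variable {β : Type*} [Fintype β]

/-- **(13) → (18) over a finite bond set**: the bondwise chart `A ↦ (expG (A b))_{b ∈ β}` is MEASURE-PRESERVING from the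
product `⊗_b (σ₀ · det jac · dX|_{N₀})` to the product Haar measure `⊗_b μ|_{N_e}` of the windows (Mathlib
`measurePreserving_pi`) — «∫dU′↾_{Ω₁}» ↦ «∫dA′↾_{Ω₁} … σ(A′(b))dA′(b)» for every closed `G ≤ U(N)`.
[cite: Balaban1985UV3, p. 260] [cite: Helgason2000, Ch. I §1 Thm. 1.14 (13) p. 96] -/
theorem exists_measurePreserving_pi_expG (μ : Measure Gs) [μ.IsHaarMeasure]
    (vol : Measure (chart Gs hG).lie) [vol.IsAddHaarMeasure] :
    ∃ r : ℝ, 0 < r ∧ r ≤ Real.log 2 ∧ IsOpen (expG Gs hG '' ball (0 : (chart Gs hG).lie) r) ∧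
      InjOn (expG Gs hG) (ball (0 : (chart Gs hG).lie) r) ∧
      (∀ X : (chart Gs hG).lie, ‖X‖ < r → 0 < jdet (hlie Gs hG) X ∧ jdet (hlie Gs hG) X < 2) ∧
      ∃ σ₀ : ℝ≥0, σ₀ ≠ 0 ∧
        MeasurePreserving (expG Gs hG) (σ₀ • jacMeasure (chart Gs hG) (hlie Gs hG) vol r)
          (μ.restrict (expG Gs hG '' ball (0 : (chart Gs hG).lie) r)) ∧
        MeasurePreserving (fun A : β → (chart Gs hG).lie => fun b => expG Gs hG (A b))
          (Measure.pi fun _ : β => σ₀ • jacMeasure (chart Gs hG) (hlie Gs hG) vol r)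
          (Measure.pi fun _ : β => μ.restrict (expG Gs hG '' ball (0 : (chart Gs hG).lie) r)) := by
  haveI : CompactSpace Gs := compactSpace Gs hG
  obtain ⟨r, hr, hr2, hopen, hinj, hjdet, σ₀, h0, hmp⟩ := exists_measurePreserving_expG Gs hG μ vol
  refine ⟨r, hr, hr2, hopen, hinj, hjdet, σ₀, h0, hmp, ?_⟩
  exact measurePreserving_pi (fun _ : β => σ₀ • jacMeasure (chart Gs hG) (hlie Gs hG) vol r)
    (fun _ : β => μ.restrict (expG Gs hG '' ball (0 : (chart Gs hG).lie) r)) fun _ => hmp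

/-- **The product integral in canonical coordinates**: with the data of `exists_measurePreserving_pi_expG`, for every
measurable `F ≥ 0` on `G^β`,
`∫ F d(⊗_b μ|_{N_e}) = ∫ F((expG A_b)_b) d(⊗_b σ₀ · det jac · dA_b|_{N₀})` — (13) → (18) as an identity of integrals.
[cite: Balaban1985UV3, p. 260] [cite: Helgason2000, Ch. I §1 Thm. 1.14 (13) p. 96] -/
theorem exists_lintegral_pi_haar_eq_expChart (μ : Measure Gs) [μ.IsHaarMeasure]
    (vol : Measure (chart Gs hG).lie) [vol.IsAddHaarMeasure] :
    ∃ r : ℝ, 0 < r ∧ r ≤ Real.log 2 ∧ IsOpen (expG Gs hG '' ball (0 : (chart Gs hG).lie) r) ∧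
      InjOn (expG Gs hG) (ball (0 : (chart Gs hG).lie) r) ∧
      (∀ X : (chart Gs hG).lie, ‖X‖ < r → 0 < jdet (hlie Gs hG) X ∧ jdet (hlie Gs hG) X < 2) ∧
      ∃ σ₀ : ℝ≥0, σ₀ ≠ 0 ∧ ∀ F : (β → Gs) → ℝ≥0∞, Measurable F →
        ∫⁻ U, F U ∂(Measure.pi fun _ : β => μ.restrict (expG Gs hG '' ball (0 : (chart Gs hG).lie) r)) =
          ∫⁻ A, F (fun b => expG Gs hG (A b))
            ∂(Measure.pi fun _ : β => σ₀ • jacMeasure (chart Gs hG) (hlie Gs hG) vol r) := by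
  obtain ⟨r, hr, hr2, hopen, hinj, hjdet, σ₀, h0, -, hpi⟩ := exists_measurePreserving_pi_expG (β := β) Gs hG μ vol
  refine ⟨r, hr, hr2, hopen, hinj, hjdet, σ₀, h0, fun F hF => ?_⟩
  rw [← hpi.map_eq, lintegral_map hF hpi.measurable]

end Literature.MathematicalPhysics.QuantumFieldTheory.Balaban1983to89.HaarExpChartPi

end
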